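/-
Copyright (c) 2026 the pub-hodgecm-mathlib formalisation cell (harness21).  Prover seat hodgecm-mathlib-K2Liu-p14 (g3), Track B «K2-LIT»,
#184♮ = hLiu418 = `stmt-HodgeConjecture-24832`; Road I v3, S5-F3 lineage ∕ I4-conv (F′-fact), E-D0: the Euler product over the Klingen fibre in NATURAL coordinates.
-/
import Summits.HodgeConjecture.HodgeConjecture.Theorems.K2LiuKlingenFibreHaarPinned           -- ★ D0 (F0P2-p09): `exists_measurableEquiv_map_prod_eq_prod_rpMeasure`
import Summits.HodgeConjecture.HodgeConjecture.Theorems.K2LiuKlingenFibreLocalCoordinates     -- ★ bridge (F0P2-p09): `exists_localCoord` (L2)(L3), `integral_comp_eq_of_map_symm` (L4)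
import Summits.HodgeConjecture.HodgeConjecture.Theorems.K2LiuKlingenInnerSectionEulerOff       -- ★ D part 2: `integral_eq_mul_tprod_of_map_eq_off`, `hasProd_integral_of_map_eq_off`
import Summits.HodgeConjecture.HodgeConjecture.Theorems.K2LiuKlingenInnerSectionLocalDefs      -- ★ B: `skewLoc`, `mem_skewLoc_iff`
import HarnessLib

/-!
# Crux `HLiu418`, I4-conv (F′-fact), E-D0 — `K2LiuKlingenFibreEulerNatural`: THE EULER PRODUCT OVER THE KLINGEN FIBRE `Y(𝔸) × 𝔸_L` IN NATURAL COORDINATES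
# `∫ F d(μ_Y ⊗ μ_T) = (∫ g_N dμ) · ∏'_{v∉T′} ∫_{Y_v × L_v} φ_v d(ν_{Y,v} ⊗ ν_{T,v})` for `F(q) = g_N(q_∞, q_{T′}) · ∏ᶠ_{v∉T′} φ_v(q.1_v, q.2_v)`, `φ_v ≡ 1` on integral points off a finite `S₀`

Cell `hodgecm-mathlib`, crux item hLiu418 = `stmt-HodgeConjecture-24832`; squad K2 ∕ K2Liu; LEAD F0P6-plan (g14) BATCH #36 (E = mine; E-D0 split offered to F0P2-p09
15:57:06Z, silence ⇒ mine 16:09:29Z); prover K2Liu-p14 (g3).  THEOREMS ONLY (no `def`, no instance, no notation, no named-fact hypothesis, no `sorry`); lane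
`--supports stmt-HodgeConjecture-24832 --as helper` (count-neutral).

THE POINT.  ★ D0∘D `K2LiuKlingenFibreEulerProduct.exists_coord_integral_eq_mul_tprod` factorises over the places of `L⁺` an integrand given in the QUADRATIC coordinates
`(E q)` of ★ D0 `K2LiuKlingenFibreHaarPinned` (local carrier `Fin 3 → L⁺_v`), with local factors `≡ 1` on `𝒪_v³` at EVERY place.  The assembly ★ E-2
`K2LiuKlingenInnerSectionFactorizable.innerSection_eq_mul_tprod_mul_finprod` wants the local factors as functions on `Y_v × L_v` (★ B `skewLoc v × LocalRing L v`,
the carrier of ★ B `innerSectionLoc`), evaluated at the NATURAL components `(q.1_v, q.2_v) = (adeleToLocal v q.1, adeleToLocal v q.2)`, normalised off a finite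
EXCEPTIONAL set only (★ E-1 `local_factor_eq_one`: the places where `(g₂)_v ∉ U(J₂)(𝒪_v)`), and the `T′`-part as a function of the archimedean parts `(q.1_∞, q.2_∞)`
and the `T′`-coordinates.  This file is that corollary: ★ D0's pin + ★ bridge `exists_localCoord` (L2: `θ_v((E q).2 v) = (q.1_v, q.2_v)`; L3: `θ_v '' 𝒪_v³ =`
integral pairs at the good places; L4: measure transport `ν_v := (ν_{Y,v} ⊗ ν_{T,v}) ∘ θ_v`) + ★ D part 2 (exceptional set) + ★ `quadraticAdeleEquiv_symm_fst`
(the archimedean parts `q.1_∞ = Ψ_∞(0, (E q).1 0)`, `q.2_∞ = Ψ_∞((E q).1 1, (E q).1 2)`, ★ `quadraticInfiniteAdeleEquiv`; ★ `fst_quadraticAdeleEquiv_symm_eq_zero` for skew `q.1`).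
* §1 `fst_eq_quadraticInfiniteAdeleEquiv` (`y_∞ = Ψ_∞((Ψ⁻¹y)₁_∞, (Ψ⁻¹y)₂_∞)`), `fst_coe_eq_of_skew` (skew `y`: `y_∞ = Ψ_∞(0, (Ψ⁻¹y)₂_∞)`).
* §2 **`exists_natural_integral_eq_mul_tprod`** — THE HEAD: for additive Haar measures `ν_{Y,v}` on `Y_v`, `ν_{T,v}` on `L_v` with `(ν_{Y,v} ⊗ ν_{T,v})(integral pairs) = 1`
  off `T′` and `T′ ⊇` the places above `2` and the places where `δ` is not a unit: `∃ μ` (additive Haar, σ-finite, on ★ D0's `T′`-carrier `(Fin 3 → L⁺_∞) × Π_{v∈T′} (Fin 3 → L⁺_v)`)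
  such that for every integrable `F` of NATURAL shape `F q = gN ((q.1_∞, q.2_∞), (T′-quadratic coords of q)) · ∏ᶠ_{v∉T′} φN v (q.1_v, q.2_v)` with `φN v ≡ 1` on integral pairs for
  `v ∉ S₀` (`S₀` finite): `∫ F d(μ_Y ⊗ μ_T) = (∫ gN ∘ (archimedean reconstruction) dμ) · ∏'_{v∉T′} ∫ φN v d(ν_{Y,v} ⊗ ν_{T,v})` (+ integrability of the tensor), and
  `hasProd_natural` — the Euler product CONVERGES when the `T′`-tensor is not a.e. zero.
[CasselsFrohlichANT1967, Ch. XV (Tate) §3.3 Thm. 3.3.1; Ch. II §10, §14], [BorelJacquet1979, §4.1].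
HONEST LABEL.  Count-neutral helper, closes no socket: `HC_CM` is proved only modulo the 7 printed citations (2 remaining named inputs: hLiu418 =
`stmt-HodgeConjecture-24832`, h413 = `stmt-HodgeConjecture-24833`) until rung 0 closes.
-/

set_option autoImplicit false
set_option linter.dupNamespace false -- the mandated namespace repeats `HodgeConjecture.HodgeConjecture`

noncomputable section

open scoped RestrictedProduct ENNReal NNReal Topology
open NumberField IsDedekindDomain MeasureTheory Measure Filter Set

namespace Summit.HodgeConjecture.HodgeConjecture.Cruxes.HLiu418.K2LiuKlingenFibreEulerNatural

open Literature.NumberTheory.Automorphic Literature.NumberTheory.Automorphic.UnitaryGroup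
open Literature.NumberTheory.GelbartRogawski1991.GRConstruction (Fp)
open Literature.MeasureTheory.RestrictedProduct
open Summit.HodgeConjecture.HodgeConjecture.Cruxes.HLiu418.K2LiuKlingenFibreHaarPinned
open Summit.HodgeConjecture.HodgeConjecture.Cruxes.HLiu418.K2LiuKlingenFibreLocalCoordinates
open Summit.HodgeConjecture.HodgeConjecture.Cruxes.HLiu418.K2LiuKlingenInnerSectionEulerOff
open Summit.HodgeConjecture.HodgeConjecture.Cruxes.HLiu418.K2LiuKlingenInnerSectionLocalDefs

variable (L : Type) [Field L] [NumberField L] [IsCMField L]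

/-! ## §1 The archimedean part of an adele of `L` from its quadratic coordinates -/

/-- `y_∞ = Ψ_∞((Ψ⁻¹ y)₁_∞, (Ψ⁻¹ y)₂_∞)` (★ `quadraticAdeleEquiv_symm_fst`: the archimedean part of `Ψ_𝔸⁻¹` is `Ψ_∞⁻¹`). [cite: CasselsFrohlichANT1967, Ch. II §10] -/
theorem fst_eq_quadraticInfiniteAdeleEquiv {δ : L} (hσδ : IsCMField.complexConj L δ = -δ) (hδ : δ ≠ 0) (y : AdeleRing (𝓞 L) L) :
    haveI : Algebra.IsQuadraticExtension (Fp L) L := IsCMField.isQuadraticExtension L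
    y.1 = quadraticInfiniteAdeleEquiv (Fp L) L (not_mem_range_algebraMap_of_apply_eq_neg L (IsCMField.complexConj L) hσδ hδ)
      (((quadraticAdeleEquiv (Fp L) L (IsCMField.complexConj L) hσδ hδ).symm y).1.1, ((quadraticAdeleEquiv (Fp L) L (IsCMField.complexConj L) hσδ hδ).symm y).2.1) := by
  haveI : Algebra.IsQuadraticExtension (Fp L) L := IsCMField.isQuadraticExtension L
  rw [quadraticAdeleEquiv_symm_fst]
  exact ((quadraticInfiniteAdeleEquiv (Fp L) L (not_mem_range_algebraMap_of_apply_eq_neg L (IsCMField.complexConj L) hσδ hδ)).apply_symm_apply _).symm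

/-- for a SKEW adele `y` (`(σ ⊗ 1) y = −y`): `y_∞ = Ψ_∞(0, (Ψ⁻¹ y)₂_∞)` (★ `fst_quadraticAdeleEquiv_symm_eq_zero`). [cite: CasselsFrohlichANT1967, Ch. II §10] -/
theorem fst_coe_eq_of_skew {δ : L} (hσδ : IsCMField.complexConj L δ = -δ) (hδ : δ ≠ 0)
    (Y : AddSubgroup (AdeleRing (𝓞 L) L)) (hY : ∀ y, y ∈ Y ↔ conjAdele (Fp L) L (IsCMField.complexConj L) y = -y) (y : ↥Y) :
    haveI : Algebra.IsQuadraticExtension (Fp L) L := IsCMField.isQuadraticExtension L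
    (y : AdeleRing (𝓞 L) L).1 = quadraticInfiniteAdeleEquiv (Fp L) L (not_mem_range_algebraMap_of_apply_eq_neg L (IsCMField.complexConj L) hσδ hδ)
      (0, ((quadraticAdeleEquiv (Fp L) L (IsCMField.complexConj L) hσδ hδ).symm (y : AdeleRing (𝓞 L) L)).2.1) := by
  haveI : Algebra.IsQuadraticExtension (Fp L) L := IsCMField.isQuadraticExtension L
  have h0 : ((quadraticAdeleEquiv (Fp L) L (IsCMField.complexConj L) hσδ hδ).symm (y : AdeleRing (𝓞 L) L)).1 = 0 :=
    fst_quadraticAdeleEquiv_symm_eq_zero (F := Fp L) (E := L) (IsCMField.complexConj L) hσδ hδ ⟨(y : AdeleRing (𝓞 L) L), (hY _).1 y.2⟩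
  have h := fst_eq_quadraticInfiniteAdeleEquiv L hσδ hδ (y : AdeleRing (𝓞 L) L)
  rw [h0] at h
  exact h

/-! ## §2 The Euler product in natural coordinates -/

/-- **THE EULER PRODUCT OVER THE KLINGEN FIBRE IN NATURAL COORDINATES** (statement in the header).  The `T′`-quadratic coordinates of `q = (y, t)` are
`v ↦ ((Ψ⁻¹y)₂|_v, (Ψ⁻¹t)₁|_v, (Ψ⁻¹t)₂|_v)` (`Ψ = ★ quadraticAdeleEquiv L⁺ L σ`), its archimedean parts are `(y_∞, t_∞)`, and its natural local components are
`(y_v, t_v) = (adeleToLocal v y, adeleToLocal v t) ∈ Y_v × L_v`; the archimedean reconstruction on ★ D0's `T′`-carrier is `x ↦ (Ψ_∞(0, x 0), Ψ_∞(x 1, x 2))`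
(★ `quadraticInfiniteAdeleEquiv`). [cite: CasselsFrohlichANT1967, Ch. XV (Tate) §3.3 Thm. 3.3.1] [cite: BorelJacquet1979, §4.1] -/
theorem exists_natural_integral_eq_mul_tprod
    [MeasurableSpace (AdeleRing (𝓞 L) L)] [BorelSpace (AdeleRing (𝓞 L) L)]
    [MeasurableSpace (InfiniteAdeleRing (Fp L))] [BorelSpace (InfiniteAdeleRing (Fp L))]
    [∀ v : HeightOneSpectrum (𝓞 (Fp L)), MeasurableSpace (v.adicCompletion (Fp L))] [∀ v : HeightOneSpectrum (𝓞 (Fp L)), BorelSpace (v.adicCompletion (Fp L))]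
    [∀ v : HeightOneSpectrum (𝓞 (Fp L)), MeasurableSpace (LocalRing L v)] [∀ v : HeightOneSpectrum (𝓞 (Fp L)), BorelSpace (LocalRing L v)]
    {δ : L} (hσδ : IsCMField.complexConj L δ = -δ) (hδ : δ ≠ 0)
    (Y : AddSubgroup (AdeleRing (𝓞 L) L)) (hY : ∀ y, y ∈ Y ↔ conjAdele (Fp L) L (IsCMField.complexConj L) y = -y)
    (μY : Measure ↥Y) (μT : Measure (AdeleRing (𝓞 L) L)) [μY.IsAddHaarMeasure] [μT.IsAddHaarMeasure]
    (T' : Finset (HeightOneSpectrum (𝓞 (Fp L))))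
    (νY : ∀ v : HeightOneSpectrum (𝓞 (Fp L)), Measure ↥(skewLoc L v)) (νT : ∀ v : HeightOneSpectrum (𝓞 (Fp L)), Measure (LocalRing L v))
    [∀ v, ((νY v).prod (νT v)).IsAddHaarMeasure]
    (h2 : ∀ v, v ∉ T' → Valued.v ((2 : Fp L) : v.adicCompletion (Fp L)) = 1)
    (hδv : ∀ v, v ∉ T' → ∀ w : PlacesOver L v, Valued.v (algebraMap L (w.1.adicCompletion L) δ) = 1)
    (hν1 : ∀ v, v ∉ T' → ((νY v).prod (νT v))
      {q : ↥(skewLoc L v) × LocalRing L v | (∀ w : PlacesOver L v, (q.1 : LocalRing L v) w ∈ w.1.adicCompletionIntegers L) ∧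
        ∀ w : PlacesOver L v, q.2 w ∈ w.1.adicCompletionIntegers L} = 1) :
    haveI : Algebra.IsQuadraticExtension (Fp L) L := IsCMField.isQuadraticExtension L
    ∃ μ : Measure ((Fin 3 → InfiniteAdeleRing (Fp L)) × (Π v : T', Fin 3 → v.1.adicCompletion (Fp L))),
      μ.IsAddHaarMeasure ∧ SigmaFinite μ ∧
      ∀ (F : ↥Y × AdeleRing (𝓞 L) L → ℂ)
        (gN : (InfiniteAdeleRing L × InfiniteAdeleRing L) × (Π v : T', Fin 3 → v.1.adicCompletion (Fp L)) → ℂ)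
        (φN : ∀ v : {v : HeightOneSpectrum (𝓞 (Fp L)) // v ∉ T'}, ↥(skewLoc L v.1) × LocalRing L v.1 → ℂ)
        (S₀ : Finset {v : HeightOneSpectrum (𝓞 (Fp L)) // v ∉ T'}),
        Integrable F (μY.prod μT) →
        (∀ v : {v : HeightOneSpectrum (𝓞 (Fp L)) // v ∉ T'}, v ∉ S₀ → ∀ q : ↥(skewLoc L v.1) × LocalRing L v.1,
          (∀ w : PlacesOver L v.1, (q.1 : LocalRing L v.1) w ∈ w.1.adicCompletionIntegers L) →
          (∀ w : PlacesOver L v.1, q.2 w ∈ w.1.adicCompletionIntegers L) → φN v q = 1) →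
        (∀ q : ↥Y × AdeleRing (𝓞 L) L, F q =
          gN ((((q.1 : AdeleRing (𝓞 L) L)).1, q.2.1),
              fun v : T' => ![((quadraticAdeleEquiv (Fp L) L (IsCMField.complexConj L) hσδ hδ).symm (q.1 : AdeleRing (𝓞 L) L)).2.2 v.1,
                ((quadraticAdeleEquiv (Fp L) L (IsCMField.complexConj L) hσδ hδ).symm q.2).1.2 v.1,
                ((quadraticAdeleEquiv (Fp L) L (IsCMField.complexConj L) hσδ hδ).symm q.2).2.2 v.1]) *
            ∏ᶠ v : {v : HeightOneSpectrum (𝓞 (Fp L)) // v ∉ T'},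
              φN v (⟨adeleToLocal L v.1 (q.1 : AdeleRing (𝓞 L) L), adeleToLocal_mem_skewLoc L v.1 ((hY _).1 q.1.2)⟩, adeleToLocal L v.1 q.2)) →
        ∫ q, F q ∂(μY.prod μT) =
            (∫ x, gN ((quadraticInfiniteAdeleEquiv (Fp L) L (not_mem_range_algebraMap_of_apply_eq_neg L (IsCMField.complexConj L) hσδ hδ) (0, x.1 0),
                quadraticInfiniteAdeleEquiv (Fp L) L (not_mem_range_algebraMap_of_apply_eq_neg L (IsCMField.complexConj L) hσδ hδ) (x.1 1, x.1 2)), x.2) ∂μ) *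
              ∏' v : {v : HeightOneSpectrum (𝓞 (Fp L)) // v ∉ T'}, ∫ q, φN v q ∂((νY v.1).prod (νT v.1)) ∧
          (¬ (fun x : (Fin 3 → InfiniteAdeleRing (Fp L)) × (Π v : T', Fin 3 → v.1.adicCompletion (Fp L)) =>
              gN ((quadraticInfiniteAdeleEquiv (Fp L) L (not_mem_range_algebraMap_of_apply_eq_neg L (IsCMField.complexConj L) hσδ hδ) (0, x.1 0),
                quadraticInfiniteAdeleEquiv (Fp L) L (not_mem_range_algebraMap_of_apply_eq_neg L (IsCMField.complexConj L) hσδ hδ) (x.1 1, x.1 2)), x.2)) =ᵐ[μ] 0 →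
            Multipliable fun v : {v : HeightOneSpectrum (𝓞 (Fp L)) // v ∉ T'} => ∫ q, φN v q ∂((νY v.1).prod (νT v.1))) := by
  classical
  haveI : Algebra.IsQuadraticExtension (Fp L) L := IsCMField.isQuadraticExtension L
  haveI : Countable (HeightOneSpectrum (𝓞 (Fp L))) := countable_heightOneSpectrum (Fp L)
  haveI : ∀ v : HeightOneSpectrum (𝓞 (Fp L)), SecondCountableTopology (v.adicCompletion (Fp L)) :=
    fun v => secondCountableTopology_adicCompletion (Fp L) v
  -- the local bridges `θ_v : L⁺_v³ ≃ₜ+ Y_v × L_v` (★ `exists_localCoord`) at every finite place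
  choose θ hθ1 hθ2 hθ3 hθL2 hθL3 using fun v : HeightOneSpectrum (𝓞 (Fp L)) => exists_localCoord L v hσδ hδ (skewLoc L v) (mem_skewLoc_iff L v)
  have hL4 := fun v : HeightOneSpectrum (𝓞 (Fp L)) => integral_comp_eq_of_map_symm L v (skewLoc L v) (θ v) ((νY v).prod (νT v))
  -- the transported local measures on `L⁺_v³`
  haveI hνH : ∀ v : HeightOneSpectrum (𝓞 (Fp L)), (((νY v).prod (νT v)).map (θ v).symm).IsAddHaarMeasure := fun v => (hL4 v).2.2 inferInstance
  haveI : ∀ v : HeightOneSpectrum (𝓞 (Fp L)), SigmaFinite (((νY v).prod (νT v)).map (θ v).symm) := fun v => inferInstance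
  have hbox : ∀ v : HeightOneSpectrum (𝓞 (Fp L)), MeasurableSet (((AddSubgroup.pi Set.univ (fun _ : Fin 3 => (v.adicCompletionIntegers (Fp L)).toSubring.toAddSubgroup) :
      AddSubgroup (Fin 3 → v.adicCompletion (Fp L))) : Set (Fin 3 → v.adicCompletion (Fp L)))) := fun v => by
    rw [K2LiuKlingenFibreCoordinates.coe_pi_integers_eq_integralBox]
    exact (isOpen_integralBox (Fp L) (Fin 3) v).measurableSet
  have hν1' : ∀ v, v ∉ T' → ((νY v).prod (νT v)).map (θ v).symm (((AddSubgroup.pi Set.univ (fun _ : Fin 3 => (v.adicCompletionIntegers (Fp L)).toSubring.toAddSubgroup) :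
      AddSubgroup (Fin 3 → v.adicCompletion (Fp L))) : Set (Fin 3 → v.adicCompletion (Fp L)))) = 1 := fun v hv => by
    rw [(hL4 v).2.1 _ (hbox v), hθL3 v (h2 v hv) (hδv v hv)]
    exact hν1 v hv
  obtain ⟨E, hE1, hE2, hE3, μ, hμ, hσ, hmap⟩ :=
    exists_measurableEquiv_map_prod_eq_prod_rpMeasure L hσδ hδ Y hY μY μT T' (fun v => ((νY v).prod (νT v)).map (θ v).symm) hν1'
  haveI := hμ
  haveI := hσ
  refine ⟨μ, hμ, hσ, fun F gN φN S₀ hFi hφN hF => ?_⟩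
  have hKne : ∀ v : {v : HeightOneSpectrum (𝓞 (Fp L)) // v ∉ T'},
      (((AddSubgroup.pi Set.univ (fun _ : Fin 3 => (v.1.adicCompletionIntegers (Fp L)).toSubring.toAddSubgroup) :
        AddSubgroup (Fin 3 → v.1.adicCompletion (Fp L))) : Set (Fin 3 → v.1.adicCompletion (Fp L)))).Nonempty :=
    fun v => ⟨0, AddSubgroup.zero_mem _⟩
  -- the shape along `E` (natural ⇒ quadratic coordinates)
  have hF' : ∀ x (y : Πʳ v : {v : HeightOneSpectrum (𝓞 (Fp L)) // v ∉ T'},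
      [Fin 3 → v.1.adicCompletion (Fp L), (AddSubgroup.pi Set.univ (fun _ : Fin 3 => (v.1.adicCompletionIntegers (Fp L)).toSubring.toAddSubgroup) :
        AddSubgroup (Fin 3 → v.1.adicCompletion (Fp L)))]),
      F (E.symm (x, y)) =
        gN ((quadraticInfiniteAdeleEquiv (Fp L) L (not_mem_range_algebraMap_of_apply_eq_neg L (IsCMField.complexConj L) hσδ hδ) (0, x.1 0),
            quadraticInfiniteAdeleEquiv (Fp L) L (not_mem_range_algebraMap_of_apply_eq_neg L (IsCMField.complexConj L) hσδ hδ) (x.1 1, x.1 2)), x.2) *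
          ∏ᶠ v : {v : HeightOneSpectrum (𝓞 (Fp L)) // v ∉ T'}, φN v (θ v.1 (y v)) := by
    intro x y
    set q := E.symm (x, y) with hqdef
    have hq : E q = (x, y) := E.apply_symm_apply _
    have hx : (E q).1 = x := by rw [hq]
    have hy : (E q).2 = y := by rw [hq]
    rw [hF q]
    congr 1
    · congr 1
      refine Prod.ext ?_ (funext fun v => ?_) <;> dsimp only
      · -- the archimedean parts
        have h1 := hE1 q
        rw [hx] at h1
        have hx0 : x.1 0 = ((quadraticAdeleEquiv (Fp L) L (IsCMField.complexConj L) hσδ hδ).symm (q.1 : AdeleRing (𝓞 L) L)).2.1 := by rw [h1]; rfl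
        have hx1 : x.1 1 = ((quadraticAdeleEquiv (Fp L) L (IsCMField.complexConj L) hσδ hδ).symm q.2).1.1 := by rw [h1]; rfl
        have hx2 : x.1 2 = ((quadraticAdeleEquiv (Fp L) L (IsCMField.complexConj L) hσδ hδ).symm q.2).2.1 := by rw [h1]; rfl
        rw [hx0, hx1, hx2, ← fst_coe_eq_of_skew L hσδ hδ Y hY q.1, ← fst_eq_quadraticInfiniteAdeleEquiv L hσδ hδ q.2]
      · -- the `T′`-quadratic coordinates
        rw [← hE2 q v, hx]
    · refine finprod_congr fun v => ?_
      rw [← hy, hE3 q v, hθL2 v.1 Y hY q.1 q.2]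
  -- local factors are `1` on `𝒪_v³` off `S₀`
  have hφK : ∀ v : {v : HeightOneSpectrum (𝓞 (Fp L)) // v ∉ T'}, v ∉ S₀ → ∀ k ∈ (((AddSubgroup.pi Set.univ
      (fun _ : Fin 3 => (v.1.adicCompletionIntegers (Fp L)).toSubring.toAddSubgroup) : AddSubgroup (Fin 3 → v.1.adicCompletion (Fp L))) :
        Set (Fin 3 → v.1.adicCompletion (Fp L)))), φN v (θ v.1 k) = 1 := by
    intro v hv k hk
    have hmem : θ v.1 k ∈ θ v.1 '' (((AddSubgroup.pi Set.univ (fun _ : Fin 3 => (v.1.adicCompletionIntegers (Fp L)).toSubring.toAddSubgroup) :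
        AddSubgroup (Fin 3 → v.1.adicCompletion (Fp L))) : Set (Fin 3 → v.1.adicCompletion (Fp L)))) := ⟨k, hk, rfl⟩
    rw [hθL3 v.1 (h2 v.1 v.2) (hδv v.1 v.2)] at hmem
    exact hφN v hv _ hmem.1 hmem.2
  have hloc : ∀ v : {v : HeightOneSpectrum (𝓞 (Fp L)) // v ∉ T'},
      ∫ d, φN v (θ v.1 d) ∂(((νY v.1).prod (νT v.1)).map (θ v.1).symm) = ∫ q, φN v q ∂((νY v.1).prod (νT v.1)) := fun v => (hL4 v.1).1 (φN v)
  have key := integral_eq_mul_tprod_of_map_eq_off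
    (fun v : {v : HeightOneSpectrum (𝓞 (Fp L)) // v ∉ T'} => (((AddSubgroup.pi Set.univ (fun _ : Fin 3 => (v.1.adicCompletionIntegers (Fp L)).toSubring.toAddSubgroup) :
      AddSubgroup (Fin 3 → v.1.adicCompletion (Fp L))) : Set (Fin 3 → v.1.adicCompletion (Fp L)))))
    (fun v => ((νY v.1).prod (νT v.1)).map (θ v.1).symm) (μY.prod μT) μ hKne (fun v => hbox v.1) (fun v => hν1' v.1 v.2) E hmap hFi
    (fun x => gN ((quadraticInfiniteAdeleEquiv (Fp L) L (not_mem_range_algebraMap_of_apply_eq_neg L (IsCMField.complexConj L) hσδ hδ) (0, x.1 0),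
      quadraticInfiniteAdeleEquiv (Fp L) L (not_mem_range_algebraMap_of_apply_eq_neg L (IsCMField.complexConj L) hσδ hδ) (x.1 1, x.1 2)), x.2))
    (fun v d => φN v (θ v.1 d)) S₀ hφK hF'
  simp_rw [hloc] at key
  refine ⟨key.2, fun hg => ?_⟩
  have key2 := hasProd_integral_of_map_eq_off
    (fun v : {v : HeightOneSpectrum (𝓞 (Fp L)) // v ∉ T'} => (((AddSubgroup.pi Set.univ (fun _ : Fin 3 => (v.1.adicCompletionIntegers (Fp L)).toSubring.toAddSubgroup) :
      AddSubgroup (Fin 3 → v.1.adicCompletion (Fp L))) : Set (Fin 3 → v.1.adicCompletion (Fp L)))))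
    (fun v => ((νY v.1).prod (νT v.1)).map (θ v.1).symm) (μY.prod μT) μ hKne (fun v => hbox v.1) (fun v => hν1' v.1 v.2) E hmap hFi
    (fun x => gN ((quadraticInfiniteAdeleEquiv (Fp L) L (not_mem_range_algebraMap_of_apply_eq_neg L (IsCMField.complexConj L) hσδ hδ) (0, x.1 0),
      quadraticInfiniteAdeleEquiv (Fp L) L (not_mem_range_algebraMap_of_apply_eq_neg L (IsCMField.complexConj L) hσδ hδ) (x.1 1, x.1 2)), x.2))
    hg (fun v d => φN v (θ v.1 d)) S₀ hφK hF'
  have hm := key2.2.multipliable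
  simp_rw [hloc] at hm
  exact hm

end Summit.HodgeConjecture.HodgeConjecture.Cruxes.HLiu418.K2LiuKlingenFibreEulerNatural

end
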